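import Literature.NumberTheory.Automorphic.UnitaryThreeDoubleCosetsHKStabilizer
import HarnessLib

/-!
# Flicker's double cosets `H∖G∕K` of the quasi-split `p`-adic `U(3)` — file 3: the NAMED subgroups `K_H`, `H^K_m`, `P_H`
# (Flicker 1998, «Elementary proof of the fundamental lemma for a unitary group», Prop. 4 p. 81, Props. 6–8 pp. 83–85)

Topic `NumberTheory/Automorphic`; namespace `Literature.NumberTheory.Automorphic.UnitaryGroup`.  THREE DEFINITIONS WITH BODIES (definition lane) + their
membership lemmas; no instance, no notation, no axiom, no named fact, no `sorry`.  Cell `pub/hodgecm-mathlib`, ENGINE T1 (crux H413 =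
`stmt-HodgeConjecture-24833`); books row #103-ns, road «N7-ns COUNT FROM FLICKER» (MAP v3, architect A-p06 (g26)), brick (F1) file 3 = the named objects the
(F3c) pen (B-p04 (g33)) and A-p03 (g24)'s LAYER C asked for (04:35Z): `P := flickerPH.subgroupOf H`, `M := (flickerHK u).subgroupOf H`, `K := flickerKH.subgroupOf H`
in ★ p840967.  Frame = files 1–2 (★ p840820 `UnitaryThreeDoubleCosetsHK`, ★ p840865∕p840889 `…HKStabilizer`): `U = U(σ, Φ₃)(K)`, `K₀ = unitaryInt σ J`,
`H = Subgroup.centralizer {c}` (`c = diag(1,−1,1)`), `u_m` Flicker's representative.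
* `flickerKH σ J c := centralizer {c} ⊓ K₀` — Flicker's `K_H = H ∩ K` [§3 p. 80].
* `flickerHK σ J c u := centralizer {c} ⊓ u K₀ u⁻¹` — Flicker's `H^K_m = H ∩ u_m K u_m⁻¹` [Prop. 4 p. 80] (`u = u_m` through the hypothesis `hu` of files 1–2;
  `mem_flickerHK_iff`: `h ∈ H^K_m ↔ h ∈ H ∧ u⁻¹ h u ∈ K₀`, so ★ `flickerU_inv_mul_mul_flickerU_mem_unitaryInt_iff` reads it by congruences).
* `flickerPH σ J c := flickerKH ⊓ B` (`B` = ★ `borelU`, upper triangular) — Flicker's `P_H ⊂ K_H`, the elements of `K_H` whose `U(1,1)`-block is upper triangular [Prop. 8 p. 85];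
  `mem_flickerPH_iff`: for `2 ≠ 0`, `h ∈ P_H ↔ h ∈ K_H ∧ h₂₀ = 0` (the block shape of `H` kills `h₁₀, h₂₁`).
HONEST LABEL: HC_CM is proved only modulo the printed citations until rung 0 closes; these are names, they pay nothing.

## References
* [Flicker1998UnitaryFL] Y. Z. Flicker, *Elementary proof of the fundamental lemma for a unitary group*, Canad. J. Math. 50 (1998), §3 p. 80 (`K`, `H`), Prop. 4 pp. 80–81
  (`H^K_m`), Props. 6–8 pp. 83–85 (`K_H`, `P_H`).
* [Rogawski1990] J. D. Rogawski, *Automorphic Representations of Unitary Groups in Three Variables* (1990), §1.10 p. 9 (`B`). -/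


open scoped MatrixGroups WithZero
open Matrix

namespace Literature.NumberTheory.Automorphic

namespace UnitaryGroup

open Literature.NumberTheory.Automorphic.HermitianLattice (unitaryInt mem_unitaryInt_iff)

section Defs

variable {K : Type*} [Field K] [Valued K ℤᵐ⁰] (σ : K →+* K) (J : Matrix (Fin 3) (Fin 3) K)

/-- **Flicker's `K_H = H ∩ K`**: the elements of `H = Z_U(c)` with integral matrix (`K₀ = U ∩ GL₃(𝒪)` = ★ `unitaryInt`). [cite: Flicker1998UnitaryFL, §3 p. 80] -/
def flickerKH (c : ↥(unitaryGroupOfForm σ J)) : Subgroup ↥(unitaryGroupOfForm σ J) :=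
  Subgroup.centralizer ({c} : Set ↥(unitaryGroupOfForm σ J)) ⊓ unitaryInt σ J

/-- **Flicker's `H^K_m = H ∩ u_m K u_m⁻¹`**, for any `u ∈ U` (the representative `u_m` enters through the hypothesis `hu` of ★ `UnitaryThreeDoubleCosetsHK`):
`centralizer {c} ⊓ (K₀.map (conj u))`. [cite: Flicker1998UnitaryFL, Prop. 4 p. 80] -/
def flickerHK (c u : ↥(unitaryGroupOfForm σ J)) : Subgroup ↥(unitaryGroupOfForm σ J) :=
  Subgroup.centralizer ({c} : Set ↥(unitaryGroupOfForm σ J)) ⊓ (unitaryInt σ J).map (MulAut.conj u).toMonoidHom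

/-- **Flicker's `P_H ⊂ K_H`**: the elements of `K_H` whose matrix is upper triangular (`K_H ⊓ B`, `B` = ★ `borelU`); for `h ∈ H` (block shape
`!![α,0,β;0,e,0;γ,0,δ]`) this is the single condition `γ = h₂₀ = 0`. [cite: Flicker1998UnitaryFL, Prop. 8 p. 85] -/
def flickerPH (c : ↥(unitaryGroupOfForm σ J)) : Subgroup ↥(unitaryGroupOfForm σ J) :=
  flickerKH σ J c ⊓ borelU σ J

variable {σ J}

/-- Membership in `K_H`. [cite: Flicker1998UnitaryFL, §3 p. 80] -/
theorem mem_flickerKH_iff {c h : ↥(unitaryGroupOfForm σ J)} :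
    h ∈ flickerKH σ J c ↔ h ∈ Subgroup.centralizer ({c} : Set ↥(unitaryGroupOfForm σ J)) ∧ h ∈ unitaryInt σ J := Iff.rfl

/-- Membership in `H^K_m`: `h ∈ H` and `u⁻¹ h u ∈ K₀` — the right conjunct is read by congruences through ★
`flickerU_inv_mul_mul_flickerU_mem_unitaryInt_iff` when `u = u_m` and `h` is in block form. [cite: Flicker1998UnitaryFL, Prop. 4 pp. 80–81] -/
theorem mem_flickerHK_iff {c u h : ↥(unitaryGroupOfForm σ J)} :
    h ∈ flickerHK σ J c u ↔ h ∈ Subgroup.centralizer ({c} : Set ↥(unitaryGroupOfForm σ J)) ∧ u⁻¹ * h * u ∈ unitaryInt σ J := by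
  rw [flickerHK, Subgroup.mem_inf, Subgroup.mem_map_equiv, MulAut.conj_symm_apply]

/-- Membership in `P_H` by definition: `h ∈ K_H` and `h` upper triangular. [cite: Flicker1998UnitaryFL, Prop. 8 p. 85] -/
theorem mem_flickerPH_iff' {c h : ↥(unitaryGroupOfForm σ J)} :
    h ∈ flickerPH σ J c ↔ h ∈ flickerKH σ J c ∧ ((h : GL (Fin 3) K) : Matrix (Fin 3) (Fin 3) K).BlockTriangular id := Iff.rfl

/-- **Membership in `P_H` for `c = diag(1,−1,1)`, residue characteristic `≠ 2`**: `h ∈ P_H ↔ h ∈ K_H ∧ h₂₀ = 0` — an element of `H` has the block shape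
`!![α,0,β;0,e,0;γ,0,δ]` (★ `apply_eq_zero_of_mem_centralizer`), so upper-triangularity is the single condition `γ = 0`. [cite: Flicker1998UnitaryFL, Prop. 8 p. 85] -/
theorem mem_flickerPH_iff (h2 : (2 : K) ≠ 0) {c h : ↥(unitaryGroupOfForm σ J)}
    (hc : ((c : GL (Fin 3) K) : Matrix (Fin 3) (Fin 3) K) = !![1, 0, 0; 0, -1, 0; 0, 0, 1]) :
    h ∈ flickerPH σ J c ↔ h ∈ flickerKH σ J c ∧ ((h : GL (Fin 3) K) : Matrix (Fin 3) (Fin 3) K) 2 0 = 0 := by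
  rw [mem_flickerPH_iff']
  refine ⟨fun ⟨hK, htri⟩ => ⟨hK, htri (by decide)⟩, fun ⟨hK, h20⟩ => ⟨hK, ?_⟩⟩
  obtain ⟨-, h10, -, h21⟩ := apply_eq_zero_of_mem_centralizer σ h2 hc hK.1
  intro i j hij
  fin_cases i <;> fin_cases j <;> simp_all

end Defs

end UnitaryGroup

end Literature.NumberTheory.Automorphic
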